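import Summits.QuantumFields.YangMills.Theorems.BalabanUVNodesN15AtRateRecord11
import Summits.QuantumFields.BalabanUV.T4Continuum.Support.HistoryFlow

/-!
# Route «BalabanUVNodes», cluster K4 «SpineRates» — node N15 = NE2 AT ANY KEYED RATE HOME (stage-generic): the K4 stub `S_N15 RRec` for every home
# `RRec` pinning, at a datum key `key F D` of ANY stage, the NE2 literal `ne2OfRecord₁₁ (ne2At h g₀ os k)` of a key-indexed NE2 reading — knit, `iff`, θ-form,
# faces, the background-live operator layer, the decided toys, component locality and POPULATEDNESS (RR-1 §8) ONCE; `RRec₁₁ 𝔯` (p457330) is an instance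
# (located-vacuous), `RRec₁₂ 𝔯` (dag-n22-e g2) the next — a record re-key costs N15 two 3-line certificates; plus the FAMILY-KEYED knit literal (`L := F.L`)

Cell `pub-ymgap`, seat `pub-ymgap-dag-n15-a` (-a KNIT-BY-NAME seat of node N15; HUMAN RULING D-0062; chair R424 venue), generation 7, file 1 (THEOREMS ONLY,
0 `def`, 0 `sorry`).  `bears_on: R4∕N15 · K3 SpineGivenEndpointR11 (→ its Stage-12 successor)`.  Filed `--supports stmt-QuantumFields-19676`.  Imports this seat's
`BalabanUVNodesN15AtRateRecord11` (p460063∕p460549; through it layer B `…RateCarriersOfRecord11` p457330 — the STAGE-FREE `ne2OfRecord₁₁`, `RateReading₁₁`,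
`rateCarriersOfRecord₁₁`, `RRec₁₁` —, RR-1's `Node00/RateRecord11` v1.1 p461303 — `NE2Objects₁₁(.Populated)` —, dag-n27-a's `…N15AtSpineCarriers` p424026
(`n15At_of_isEmpty`), dag-n15-c's `…N15AtSpineCarriersBackground` p456241 (`s_N15_of_background₁Reading`), this seat's `…N15Knit` p409413
(`N15_with_zero_layers_dim4`, `not_N15op_rateless`) and `Literature/…/NE2NodeTorus` p408986 (the knit carriers)).  Pattern: dag-n16-e's
`BalabanUVNodesN16AtKeyedHome` (NE3's keyed home).  Restates nothing.

WHY (pub-ymgap INBOX l.12862 ∕ l.13002 ∕ l.13054 ∕ l.13248, 2026-08-26).  node00-def-T LOCATED-2: `Stage11Params.Provisos₁₁` is uninhabited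
(`Node00.not_isRecordOfRecord₁₁C`), so the Stage-11 key `IsDatumOfRecord₁₁C` is EMPTY and every K4 stub at `RRec₁₁ 𝔯` — among them this seat's
`N15.AtRateRecord11.s_N15_rRec₁₁_of_layers` — holds with no estimate (dag-n22-e `k4_rRec₁₁_outright`); content re-keys to Stage 12 (`RRec₁₂`, dag-n22-e g2 over
node00-def-RR-2's `Node00/Record12DatumKey`), and the record has already moved ₉ → ₁₀ → ₁₁ → ₁₂.  N15's side of a rate home depends on TWO data: WHICH key the
home quantifies over, and WHICH NE2 object of RR-1's stage-free `Node00.NE2Objects₁₁` the reading assigns at a key, `g₀`, `os` and run length `k`.  So this file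
states N15's home theorems over an arbitrary KEY `key : (F : T4Family) → Datum F N → Prop` (`IsDatumOfRecord₁₁C`, `IsDatumOfRecord₁₂C`, …), an arbitrary
KEY-INDEXED NE2 READING `ne2At : key F D → (ℕ → ℝ) → List (ULoop F) → ℕ → NE2Objects₁₁` (at ₁₁: `(𝔯.lit F h.params g₀ os).ne2 k`; at ₁₂:
`(𝔯.lit F h.params h.provisos g₀ os).ne2 k`), and an arbitrary home `RRec : RateRecordPred N` that ADMITS only the reading's literals (`hadm`: every pinned
bundle's `R.ne2` is `ne2OfRecord₁₁ (ne2At h g₀ os k)` for some key proof `h` and run length `k`) and, for the converse directions, ATTAINS them (`hatt`) — both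
ONE-LINE facts for a home of layer B's shape `fun F D g₀ os R => ∃ (h : key F D) k, R = carriers … h … g₀ os k` (§7 certifies them for `RRec₁₁ 𝔯`).

CONTENT.
§1 `s_N15_of_admits` (N15 at every literal ⇒ `S_N15 RRec`), `s_N15_iff_of_admits_attains` (`S_N15 RRec` IS «N15 at every key and run length»).
§2 THE LAYERED KNIT AND ITS θ-FORM, once: `s_N15_of_admits_layers` (the three NE2⁺ layers — operator (3.42), site-kernel (3.48) at `d = 4`, unit-lattice
   (3.187) — at every literal ⇒ `S_N15 RRec`), `s_N15_of_admits_forall_params` ∕ `s_N15_of_admits_layers_forall_params` (the reading FACTORS through a parameter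
   map `par : key F D → Θ F` landing in a «good» set — admissible-with-provisos — and the prover discharges `N15At` ∕ the three layers at EVERY good parameter;
   no canonical parameter in sight — the `h15` shape a K4 join consumes at any stage).
§3 THE CONSUMER FACES, once (under `S_N15 RRec`, home ATTAINING the literals): `n15At_of_attains`, `ne2PlusOperator_of_attains`, `ne2PlusSite_of_attains`,
   `ne2PlusUnit_of_attains` (N17's composite ∕ N19's `RatesAt` read these).
§4 THE OPERATOR LAYER WITH THE BACKGROUND BLOCK LIVE, once: `s_N15_of_admits_background₁` (a reading whose NE2 objects at every key are dag-n15-c's first-order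
   background-live vector-piece carriers has `S_N15 RRec` from the SITE and UNIT layers alone — the operator conjunct is the producer's theorem
   `VectorPiece.ne2PlusOperator_vectorPiece_background₁`, via `N15AtSpineCarriers.s_N15_of_background₁Reading RRec`).
§5 THE DECIDED TOYS AND POPULATEDNESS, once [decided toys]: `s_N15_of_admits_emptyIndex` (empty index at every key ⇒ the stub with NO estimate — n27-a's
   A2 trap `n15At_of_isEmpty`), `s_N15_of_admits_not_populated` (the same read through RR-1 §8's display: a reading whose NE2 objects are nowhere `Populated`
   closes the stub content-free — dag-ref-H (A1) «a knit at a NAMED 𝔯 counts only with non-empty index types displayed», in the kernel for NE2),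
   `populated_knitObjects` ∕ `not_populated_emptyIndexObjects` (the display HOLDS at the LG-vector knit literal and FAILS at the empty-index literal),
   `s_N15_of_admits_knit` (the knit literals ⇒ `S_N15 RRec` HYPOTHESIS-FREE, non-degenerate: `N15Knit.N15_with_zero_layers_dim4`), `not_s_N15_of_pins_rateless`
   (key-free: a home pinning ONE bundle whose NE2 component is the RATE-LESS literal `X_N k ≡ 2^k` on `knitInstance 3 2` has `¬ S_N15 RRec` —
   `N15Knit.not_N15op_rateless`), `exists_ne2At_const` (every key type carries the constant reading at any prescribed `o`).
§6 COMPONENT LOCALITY, once: `s_N15_of_admits_attains_ne2_agree` (two homes over the same key whose readings agree have the same `S_N15`, one direction;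
   `ne1` ∕ `ne3` ∕ `u3` never enter) and `s_N15_of_admits_pin` (the reading agrees with a NAMED key-indexed pin carrying `N15At` ⇒ `S_N15 RRec`).
§7 THE STAGE-11 INSTANCE CERTIFICATES: `admits_rRec₁₁_ne2`, `attains_rRec₁₁_ne2` (`key := IsDatumOfRecord₁₁C`, `ne2At h g₀ os k := (𝔯.lit F h.params g₀ os).ne2 k`)
   and the check `s_N15_rRec₁₁_iff_keyed` (§1's `iff` at the instance = layer B's `s_N15_rRec₁₁_iff`); with them §1–§6 at `RRec₁₁ 𝔯` are this seat's
   `N15.AtRateRecord11` theorems — not restated; located-vacuous at ₁₁; the ₁₂ certificates are two 3-line theorems of file 2 once `RRec₁₂` lands.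
§8 THE FAMILY-KEYED KNIT LITERAL: `neZero_blockFactor` (`NeZero F.L` — a `Prop`, from `HistoryFlow.two_le_L` of `…T4Continuum.Support.HistoryFlow`,
   imported for it), `s_N15_of_admits_knit_family` (the knit literals at the datum family's OWN block factor `L := F.L` ⇒ `S_N15 RRec` hypothesis-free) — the reading
   reads the family, the estimate is `N15_with_zero_layers_dim4` at `2 ≤ F.L`.

HONEST FRAMING.  Kernel bookkeeping by name, stage-generic; no estimate; every reading is UNPINNED; the hypothesis-free inhabitant (§5, §8) is the `U ≡ 1`
Landau-gauge LG-VECTOR TORUS MODEL of this lineage (backgrounds = the one-point carrier, (3.35)∕(3.36) trivial ⇒ NE2⁰ content inside NE2⁺'s type; rates ∕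
decay ∕ index-uniformity genuine), NOT Bałaban's multiscale `G(U)`; in §4 only the OPERATOR layer of the LINEAR vector single-scale piece dressed by the
ABELIAN first-order species enters hypothesis-free, the SITE and UNIT layers are DISPLAYED (no producer with the background live exists in the tree); NE2⁺ is
NOT PRINTED beyond King's scalar template ([King1986] Lemma 4.5 (4.38) p.674) and NOT PROVED; no datum key of any stage is claimed inhabited (K0 ∕ K0′);
**N15 ∕ NE2 is NOT discharged** (typed 28∕28, discharged count untouched); count-neutral; one finite four-torus programme at fixed `ε` — NOT ℝ⁴, NOT infinite
volume, NOT OS, NOT a mass gap, NOT Clay.  Restate-immune and re-pin-immune (no Theses import, no `Record11` ∕ `Record12` decl read).  No decl below carries a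
cite tag.
-/

set_option autoImplicit false

noncomputable section
namespace Summit.QuantumFields.YangMills.BalabanUVNodes.N15.AtKeyedHome

open Literature.MathematicalPhysics.QuantumFieldTheory.Balaban1983to89
open Literature.MathematicalPhysics.QuantumFieldTheory.Balaban1983to89.T4Continuum (T4Family ULoop)
open Literature.MathematicalPhysics.QuantumFieldTheory.Balaban1983to89.T4EtaRate (PairedInstance NE2PlusOperator NE2PlusSite NE2PlusUnit)
open Literature.MathematicalPhysics.QuantumFieldTheory.Balaban1983to89.NE2NodeTorus (KnitIndex knitInstance knitOp knitOp166 knitSite163 covOpKernels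
  inAll rhoDist)
open Node00 (IsDatumOfRecord₁₁C Stage11Params NE2Objects₁₁)
open Summit.QuantumFields.BalabanUV.T4Continuum.HistoryFlow (two_le_L)
open Summit.QuantumFields.YangMills.Theorems.BalabanUVNodesN15Knit (not_N15op_rateless N15_with_zero_layers_dim4)
open Summit.QuantumFields.YangMills.Theorems.N15AtSpineCarriers (s_N15_of_background₁Reading n15At_of_isEmpty)
open Summit.QuantumFields.YangMills.BalabanUVNodes.N15.VectorPiece (VecIndexS bgVecInstance₁ bgVecFamily₁4)
open YMDAG.UVSplit (Datum NE2Carriers RateCarriers RateRecordPred N15At S_N15 ne2OfRecord₁₁ RateReading₁₁ rateCarriersOfRecord₁₁ RRec₁₁)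

variable {N : ℕ} [NeZero N]

section KeyedHome

variable {key : (F : T4Family) → Datum F N → Prop}
  (ne2At : ∀ {F : T4Family} {D : Datum F N}, key F D → (ℕ → ℝ) → List (ULoop F) → ℕ → NE2Objects₁₁)
  (RRec : RateRecordPred N)

/-! ## §1 `S_N15` at a home admitting ∕ attaining the literals of a key-indexed NE2 reading -/

/-- **N15 AT EVERY LITERAL GIVES THE STUB**: if the home admits only bundles whose NE2 component is the literal `ne2OfRecord₁₁ (ne2At h g₀ os k)` of the reading at
some key proof and run length (`hadm`), and `N15At` holds at every such literal, then `S_N15 RRec`. [bookkeeping] -/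
theorem s_N15_of_admits
    (hadm : ∀ (F : T4Family) (D : Datum F N) (g₀ : ℕ → ℝ) (os : List (ULoop F)) (R : RateCarriers N), RRec F D g₀ os R →
      ∃ (h : key F D) (k : ℕ), R.ne2 = ne2OfRecord₁₁ (ne2At h g₀ os k))
    (h15 : ∀ (F : T4Family) (D : Datum F N) (h : key F D) (g₀ : ℕ → ℝ) (os : List (ULoop F)) (k : ℕ), N15At (ne2OfRecord₁₁ (ne2At h g₀ os k))) :
    S_N15 RRec := by
  intro F D g₀ os R hR
  obtain ⟨h, k, hne2⟩ := hadm F D g₀ os R hR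
  rw [hne2]
  exact h15 F D h g₀ os k

/-- **`S_N15 RRec` IS «N15 AT EVERY KEY AND RUN LENGTH»** for a home that admits (`hadm`) and attains (`hatt`) exactly the reading's literals. [bookkeeping] -/
theorem s_N15_iff_of_admits_attains
    (hadm : ∀ (F : T4Family) (D : Datum F N) (g₀ : ℕ → ℝ) (os : List (ULoop F)) (R : RateCarriers N), RRec F D g₀ os R →
      ∃ (h : key F D) (k : ℕ), R.ne2 = ne2OfRecord₁₁ (ne2At h g₀ os k))
    (hatt : ∀ (F : T4Family) (D : Datum F N) (h : key F D) (g₀ : ℕ → ℝ) (os : List (ULoop F)) (k : ℕ),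
      ∃ R : RateCarriers N, RRec F D g₀ os R ∧ R.ne2 = ne2OfRecord₁₁ (ne2At h g₀ os k)) :
    S_N15 RRec ↔
      ∀ (F : T4Family) (D : Datum F N) (h : key F D) (g₀ : ℕ → ℝ) (os : List (ULoop F)) (k : ℕ), N15At (ne2OfRecord₁₁ (ne2At h g₀ os k)) := by
  refine ⟨fun hS F D h g₀ os k => ?_, s_N15_of_admits ne2At RRec hadm⟩
  obtain ⟨R, hR, hne2⟩ := hatt F D h g₀ os k
  have h15 := hS F D g₀ os R hR
  rwa [hne2] at h15

/-! ## §2 The layered knit and its θ-form, once -/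

/-- **THE LAYERED KNIT AT ANY KEYED HOME** — `S_N15 RRec` from the three NE2⁺ layers (operator (3.42) ∕ site-kernel (3.48) at `d = 4` ∕ unit-lattice (3.187), each
with an η-difference) at every literal of the reading; one application of `s_N15_of_admits` through the `Iff.rfl` face `n15At_ne2OfRecord₁₁_iff`.  No layer is
asserted here. [bookkeeping] -/
theorem s_N15_of_admits_layers
    (hadm : ∀ (F : T4Family) (D : Datum F N) (g₀ : ℕ → ℝ) (os : List (ULoop F)) (R : RateCarriers N), RRec F D g₀ os R →
      ∃ (h : key F D) (k : ℕ), R.ne2 = ne2OfRecord₁₁ (ne2At h g₀ os k))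
    (h : ∀ (F : T4Family) (D : Datum F N) (h : key F D) (g₀ : ℕ → ℝ) (os : List (ULoop F)) (k : ℕ),
      NE2PlusOperator (ne2At h g₀ os k).c35 (ne2At h g₀ os k).pi (ne2At h g₀ os k).Kop ∧
      NE2PlusSite 4 (ne2At h g₀ os k).p (ne2At h g₀ os k).c35 (ne2At h g₀ os k).pi (ne2At h g₀ os k).Ksite ∧
      NE2PlusUnit (ne2At h g₀ os k).c35 (ne2At h g₀ os k).pi (ne2At h g₀ os k).Kunit (ne2At h g₀ os k).inΛ (ne2At h g₀ os k).unitDist) :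
    S_N15 RRec :=
  s_N15_of_admits ne2At RRec hadm fun F D hk g₀ os k => (AtRateRecord11.n15At_ne2OfRecord₁₁_iff _).2 (h F D hk g₀ os k)

/-- **THE θ-FORM OF THE KNIT AT ANY KEYED HOME** — what a prover of the pin discharges, no canonical parameter in sight.  Suppose the key-indexed reading FACTORS
through a parameter map, `ne2At h g₀ os k = ρ F (par h) g₀ os k`, for a stage's parameter type `Θ F` (at ₁₁: `Stage11Params F N`, `par h = h.params`; at ₁₂: the
provisos-carrying pairs, `par h = ⟨h.params, h.provisos⟩`), every key's parameter being GOOD (`good F (par h)`: admissible with provisos).  If `N15At` holds at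
the reading `ρ` for EVERY good parameter along every `(g₀, os, k)`, then `S_N15 RRec`. [bookkeeping] -/
theorem s_N15_of_admits_forall_params {Θ : T4Family → Type*} (ρ : (F : T4Family) → Θ F → (ℕ → ℝ) → List (ULoop F) → ℕ → NE2Objects₁₁)
    (good : (F : T4Family) → Θ F → Prop) (par : ∀ {F : T4Family} {D : Datum F N}, key F D → Θ F)
    (hpar : ∀ (F : T4Family) (D : Datum F N) (h : key F D), good F (par h))
    (hfac : ∀ (F : T4Family) (D : Datum F N) (h : key F D) (g₀ : ℕ → ℝ) (os : List (ULoop F)) (k : ℕ), ne2At h g₀ os k = ρ F (par h) g₀ os k)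
    (hadm : ∀ (F : T4Family) (D : Datum F N) (g₀ : ℕ → ℝ) (os : List (ULoop F)) (R : RateCarriers N), RRec F D g₀ os R →
      ∃ (h : key F D) (k : ℕ), R.ne2 = ne2OfRecord₁₁ (ne2At h g₀ os k))
    (h : ∀ (F : T4Family) (θ : Θ F), good F θ → ∀ (g₀ : ℕ → ℝ) (os : List (ULoop F)) (k : ℕ), N15At (ne2OfRecord₁₁ (ρ F θ g₀ os k))) :
    S_N15 RRec :=
  s_N15_of_admits ne2At RRec hadm fun F D hk g₀ os k => by
    rw [hfac F D hk g₀ os k]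
    exact h F (par hk) (hpar F D hk) g₀ os k

/-- **THE θ-FORM, LAYERS SPELLED OUT** — the three NE2⁺ layers at the reading `ρ` for every good parameter ⇒ `S_N15 RRec`. [bookkeeping] -/
theorem s_N15_of_admits_layers_forall_params {Θ : T4Family → Type*} (ρ : (F : T4Family) → Θ F → (ℕ → ℝ) → List (ULoop F) → ℕ → NE2Objects₁₁)
    (good : (F : T4Family) → Θ F → Prop) (par : ∀ {F : T4Family} {D : Datum F N}, key F D → Θ F)
    (hpar : ∀ (F : T4Family) (D : Datum F N) (h : key F D), good F (par h))
    (hfac : ∀ (F : T4Family) (D : Datum F N) (h : key F D) (g₀ : ℕ → ℝ) (os : List (ULoop F)) (k : ℕ), ne2At h g₀ os k = ρ F (par h) g₀ os k)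
    (hadm : ∀ (F : T4Family) (D : Datum F N) (g₀ : ℕ → ℝ) (os : List (ULoop F)) (R : RateCarriers N), RRec F D g₀ os R →
      ∃ (h : key F D) (k : ℕ), R.ne2 = ne2OfRecord₁₁ (ne2At h g₀ os k))
    (h : ∀ (F : T4Family) (θ : Θ F), good F θ → ∀ (g₀ : ℕ → ℝ) (os : List (ULoop F)) (k : ℕ),
      NE2PlusOperator (ρ F θ g₀ os k).c35 (ρ F θ g₀ os k).pi (ρ F θ g₀ os k).Kop ∧
      NE2PlusSite 4 (ρ F θ g₀ os k).p (ρ F θ g₀ os k).c35 (ρ F θ g₀ os k).pi (ρ F θ g₀ os k).Ksite ∧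
      NE2PlusUnit (ρ F θ g₀ os k).c35 (ρ F θ g₀ os k).pi (ρ F θ g₀ os k).Kunit (ρ F θ g₀ os k).inΛ (ρ F θ g₀ os k).unitDist) :
    S_N15 RRec :=
  s_N15_of_admits_forall_params ne2At RRec ρ good par hpar hfac hadm fun F θ hθ g₀ os k =>
    (AtRateRecord11.n15At_ne2OfRecord₁₁_iff _).2 (h F θ hθ g₀ os k)

/-! ## §3 The consumer faces, once -/

section Faces

variable (hatt : ∀ (F : T4Family) (D : Datum F N) (h : key F D) (g₀ : ℕ → ℝ) (os : List (ULoop F)) (k : ℕ),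
    ∃ R : RateCarriers N, RRec F D g₀ os R ∧ R.ne2 = ne2OfRecord₁₁ (ne2At h g₀ os k))
  (hS : S_N15 RRec) (F : T4Family) (D : Datum F N) (h : key F D) (g₀ : ℕ → ℝ) (os : List (ULoop F)) (k : ℕ)
include hatt hS

/-- **WHAT THE STUB AT A KEYED HOME DELIVERS**: `N15At` at the literal of every key, `(g₀, os)` and run length (the home must ATTAIN the literal). [bookkeeping] -/
theorem n15At_of_attains : N15At (ne2OfRecord₁₁ (ne2At h g₀ os k)) := by
  obtain ⟨R, hR, hne2⟩ := hatt F D h g₀ os k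
  have h15 := hS F D g₀ os R hR
  rwa [hne2] at h15

/-- Consumer face: the OPERATOR layer at the reading's NE2 objects of a key. [bookkeeping] -/
theorem ne2PlusOperator_of_attains : NE2PlusOperator (ne2At h g₀ os k).c35 (ne2At h g₀ os k).pi (ne2At h g₀ os k).Kop :=
  (n15At_of_attains ne2At RRec hatt hS F D h g₀ os k).1

/-- Consumer face: the SITE-KERNEL layer (`d = 4`) at the reading's NE2 objects of a key. [bookkeeping] -/
theorem ne2PlusSite_of_attains : NE2PlusSite 4 (ne2At h g₀ os k).p (ne2At h g₀ os k).c35 (ne2At h g₀ os k).pi (ne2At h g₀ os k).Ksite :=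
  (n15At_of_attains ne2At RRec hatt hS F D h g₀ os k).2.1

/-- Consumer face: the UNIT-LATTICE layer at the reading's NE2 objects of a key. [bookkeeping] -/
theorem ne2PlusUnit_of_attains :
    NE2PlusUnit (ne2At h g₀ os k).c35 (ne2At h g₀ os k).pi (ne2At h g₀ os k).Kunit (ne2At h g₀ os k).inΛ (ne2At h g₀ os k).unitDist :=
  (n15At_of_attains ne2At RRec hatt hS F D h g₀ os k).2.2

end Faces

/-! ## §4 The operator layer with the background block LIVE, once -/

/-- **THE OPERATOR LAYER WITH THE BACKGROUND BLOCK LIVE, AT ANY KEYED HOME.**  For `d + 1 ≥ 2`, `L ≥ 1`: if at every key, `(g₀, os)` and run length the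
reading's NE2 objects ARE dag-n15-c's FIRST-ORDER background-live vector-piece carriers — index `VecIndexS d L`, paired instances `VectorPiece.bgVecInstance₁ L hL`
(coefficient carriers = the (3.35) letter pair with the index's OWN `M`: guard LIVE), operator kernels the CONSTRUCTED `VectorPiece.bgVecFamily₁4 L hL` (all four
(3.42) entries), any `c35 > 0`, `p`, site ∕ unit kernels, region, unit distance — together with the SITE and UNIT layers on them, then `S_N15 RRec`: the operator
conjunct is the producer's theorem `VectorPiece.ne2PlusOperator_vectorPiece_background₁` (via `N15AtSpineCarriers.s_N15_of_background₁Reading RRec`), NOT a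
hypothesis.  Honest scope: the LINEAR (`U = 1`) vector single-scale piece dressed by the ABELIAN first-order species — NOT Bałaban's `G(U)`. [bookkeeping] -/
theorem s_N15_of_admits_background₁ {d L : ℕ} [NeZero L] (hd : 1 ≤ d) (hL : 1 ≤ L)
    (hadm : ∀ (F : T4Family) (D : Datum F N) (g₀ : ℕ → ℝ) (os : List (ULoop F)) (R : RateCarriers N), RRec F D g₀ os R →
      ∃ (h : key F D) (k : ℕ), R.ne2 = ne2OfRecord₁₁ (ne2At h g₀ os k))
    (h : ∀ (F : T4Family) (D : Datum F N) (hk : key F D) (g₀ : ℕ → ℝ) (os : List (ULoop F)) (k : ℕ),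
      ∃ (c35 p : ℝ) (Ksite Kunit : ∀ j : VecIndexS d L, B9.SiteKernel (bgVecInstance₁ (d := d) L hL j).gc (bgVecInstance₁ (d := d) L hL j).Bf)
        (inΛ : ∀ j : VecIndexS d L, (bgVecInstance₁ (d := d) L hL j).gc.Site → Prop)
        (unitDist : ∀ j : VecIndexS d L, (bgVecInstance₁ (d := d) L hL j).gc.Site → (bgVecInstance₁ (d := d) L hL j).gc.Site → ℝ),
        0 < c35 ∧
        ne2At hk g₀ os k =
          { I := VecIndexS d L, c35 := c35, p := p, pi := bgVecInstance₁ (d := d) L hL, Kop := bgVecFamily₁4 (d := d) L hL,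
            Ksite := Ksite, Kunit := Kunit, inΛ := inΛ, unitDist := unitDist } ∧
        NE2PlusSite 4 p c35 (bgVecInstance₁ (d := d) L hL) Ksite ∧ NE2PlusUnit c35 (bgVecInstance₁ (d := d) L hL) Kunit inΛ unitDist) :
    S_N15 RRec := by
  refine s_N15_of_background₁Reading hd hL RRec ?_
  intro F D g₀ os R hR
  obtain ⟨hk, k, hne2⟩ := hadm F D g₀ os R hR
  obtain ⟨c35, p, Ksite, Kunit, inΛ, unitDist, hc35, hlit, hsite, hunit⟩ := h F D hk g₀ os k
  refine ⟨c35, p, Ksite, Kunit, inΛ, unitDist, hc35, ?_, hsite, hunit⟩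
  rw [hne2, hlit]
  rfl

/-! ## §5 The decided toys and populatedness, once: the pin of the reading decides -/

/-- **A2 TRAP AT ANY KEYED HOME — A READING WITHOUT PAIRED INSTANCES CLOSES THE STUB WITH NO ESTIMATE** [decided toy]: if every NE2 object the reading assigns
has an EMPTY index of paired instances, then `S_N15 RRec` vacuously (n27-a's `n15At_of_isEmpty`); the PIN owes an INHABITED run-indexed `I`. [bookkeeping] -/
theorem s_N15_of_admits_emptyIndex
    (hadm : ∀ (F : T4Family) (D : Datum F N) (g₀ : ℕ → ℝ) (os : List (ULoop F)) (R : RateCarriers N), RRec F D g₀ os R →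
      ∃ (h : key F D) (k : ℕ), R.ne2 = ne2OfRecord₁₁ (ne2At h g₀ os k))
    (h : ∀ (F : T4Family) (D : Datum F N) (h : key F D) (g₀ : ℕ → ℝ) (os : List (ULoop F)) (k : ℕ), IsEmpty (ne2At h g₀ os k).I) :
    S_N15 RRec :=
  s_N15_of_admits ne2At RRec hadm fun F D hk g₀ os k => @n15At_of_isEmpty (ne2OfRecord₁₁ (ne2At hk g₀ os k)) (h F D hk g₀ os k)

/-- **THE SAME TRAP READ THROUGH RR-1's DISPLAY** [decided toy]: a reading whose NE2 objects are NOWHERE `Populated` (RR-1 §8: `Nonempty o.I`) closes the stub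
CONTENT-FREE — the display is NECESSARY for content at any home (dag-ref-H (A1)), never sufficient (`not_s_N15_of_pins_rateless`). [bookkeeping] -/
theorem s_N15_of_admits_not_populated
    (hadm : ∀ (F : T4Family) (D : Datum F N) (g₀ : ℕ → ℝ) (os : List (ULoop F)) (R : RateCarriers N), RRec F D g₀ os R →
      ∃ (h : key F D) (k : ℕ), R.ne2 = ne2OfRecord₁₁ (ne2At h g₀ os k))
    (h : ∀ (F : T4Family) (D : Datum F N) (h : key F D) (g₀ : ℕ → ℝ) (os : List (ULoop F)) (k : ℕ), ¬ (ne2At h g₀ os k).Populated) :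
    S_N15 RRec :=
  s_N15_of_admits_emptyIndex ne2At RRec hadm fun F D hk g₀ os k =>
    not_nonempty_iff.1 fun hne => h F D hk g₀ os k ((NE2Objects₁₁.populated_iff _).2 hne)

/-- **THE LG-VECTOR KNIT READING CLOSES THE STUB AT ANY KEYED HOME, HYPOTHESIS-FREE AND NON-DEGENERATE** [decided toy].  For every `L ≥ 2`, `μ ≠ ν`,
labels `a b μ′ λ α β`, letters `c35`, `p`: if at every key, `(g₀, os)` and run length the reading's NE2 objects are the KNIT CARRIERS of this lineage's `U ≡ 1`
Landau-gauge vector linear theory on the four-dimensional unit tori — index `KnitIndex 3 L` (INHABITED), instances `knitInstance 3 L`, operator kernels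
`knitOp166 L μ ν a b` = Δ_k (1.66), site kernels `knitSite163 L μ′ λ` = H_k (1.63), unit kernels `covOpKernels L α β` = C^{(k)} (2.156), `inAll`, `rhoDist` —
then `S_N15 RRec`, by `N15Knit.N15_with_zero_layers_dim4` (King's γ = 2 ∕ γ = 1 ∕ θ = L⁻¹; rates, decay, uniformity genuine).  MODEL level: NOT Bałaban's
multiscale `G(U)`. [bookkeeping] -/
theorem s_N15_of_admits_knit (L : ℕ) [NeZero L] (hL : 2 ≤ L) {μ ν : Fin 4} (hμν : μ ≠ ν) (a b μ' lam α β : Fin 4) (c35 p : ℝ)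
    (hadm : ∀ (F : T4Family) (D : Datum F N) (g₀ : ℕ → ℝ) (os : List (ULoop F)) (R : RateCarriers N), RRec F D g₀ os R →
      ∃ (h : key F D) (k : ℕ), R.ne2 = ne2OfRecord₁₁ (ne2At h g₀ os k))
    (h : ∀ (F : T4Family) (D : Datum F N) (h : key F D) (g₀ : ℕ → ℝ) (os : List (ULoop F)) (k : ℕ),
      ne2At h g₀ os k =
        { I := KnitIndex 3 L, c35 := c35, p := p, pi := knitInstance 3 L, Kop := knitOp166 L μ ν a b, Ksite := knitSite163 L μ' lam,
          Kunit := covOpKernels L α β, inΛ := inAll L, unitDist := rhoDist L }) :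
    S_N15 RRec :=
  s_N15_of_admits ne2At RRec hadm fun F D hk g₀ os k => by
    rw [h F D hk g₀ os k]
    exact (N15_with_zero_layers_dim4 L hL hμν a b μ' lam α β c35 p).1

end KeyedHome

/-- **RR-1's DISPLAY HOLDS AT THE KNIT LITERAL**: the LG-vector knit objects are `Populated` (`NE2NodeTorus.knitIndex_nonempty`: the L-divisible torus index carries
the cube `KnitIndex.cube`). [bookkeeping] -/
theorem populated_knitObjects (L : ℕ) [NeZero L] (μ ν a b μ' lam α β : Fin 4) (c35 p : ℝ) :
    ({ I := KnitIndex 3 L, c35 := c35, p := p, pi := knitInstance 3 L, Kop := knitOp166 L μ ν a b, Ksite := knitSite163 L μ' lam,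
        Kunit := covOpKernels L α β, inΛ := inAll L, unitDist := rhoDist L } : NE2Objects₁₁).Populated :=
  (NE2Objects₁₁.populated_iff _).2 (inferInstance : Nonempty (KnitIndex 3 L))

/-- **RR-1's DISPLAY FAILS AT THE EMPTY-INDEX LITERAL**: the NE2 objects with NO paired instance (index `PEmpty`, no kernel) are NOT `Populated` — the corner the A2
trap `s_N15_of_admits_emptyIndex` lives in is excluded by the display. [bookkeeping] -/
theorem not_populated_emptyIndexObjects (c35 p : ℝ) :
    ¬ NE2Objects₁₁.Populated
        { I := PEmpty, c35 := c35, p := p, pi := PEmpty.elim, Kop := fun i => i.elim, Ksite := fun i => i.elim, Kunit := fun i => i.elim,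
          inΛ := fun i => i.elim, unitDist := fun i => i.elim } :=
  fun h => by
    obtain ⟨i⟩ := (NE2Objects₁₁.populated_iff _).1 h
    exact i.elim

/-- **A HOME PINNING ONE RATE-LESS LITERAL HAS NO `S_N15`** [decided toy] (key-free): if SOME pinned bundle's NE2 component is the literal of the objects
carrying, on `knitInstance 3 2`, the RATE-LESS operator family `X_N k ≡ 2^k` — whatever `c35`, `p`, the site ∕ unit kernels —, the stub FAILS
(`N15Knit.not_N15op_rateless`: the operator layer would force `2^k ≤ B₀` for all `k`).  Such objects ARE `Populated`: the display is necessary, never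
sufficient; N15's content at any home is a genuine RATE of the pinned operator family. [bookkeeping] -/
theorem not_s_N15_of_pins_rateless (RRec : RateRecordPred N) {F : T4Family} {D : Datum F N} {g₀ : ℕ → ℝ} {os : List (ULoop F)} {R : RateCarriers N}
    (hR : RRec F D g₀ os R) (c35 p : ℝ) (μ' lam α β : Fin 4)
    (hne2 : R.ne2 = ne2OfRecord₁₁
      { I := KnitIndex 3 2, c35 := c35, p := p, pi := knitInstance 3 2, Kop := knitOp 2 (fun _ _ k _ => (2 : ℝ) ^ k),
        Ksite := knitSite163 2 μ' lam, Kunit := covOpKernels 2 α β, inΛ := inAll 2, unitDist := rhoDist 2 }) :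
    ¬ S_N15 RRec := fun hS => by
  have h15 := hS F D g₀ os R hR
  rw [hne2] at h15
  exact not_N15op_rateless 3 c35 h15.1

/-- **EVERY KEY TYPE CARRIES THE CONSTANT READING** at any prescribed NE2 objects `o` (so the toys bite at every stage's home of layer B's shape). [bookkeeping] -/
theorem exists_ne2At_const {key : (F : T4Family) → Datum F N → Prop} (o : NE2Objects₁₁) :
    ∃ ne2At : ∀ {F : T4Family} {D : Datum F N}, key F D → (ℕ → ℝ) → List (ULoop F) → ℕ → NE2Objects₁₁,
      ∀ (F : T4Family) (D : Datum F N) (h : key F D) (g₀ : ℕ → ℝ) (os : List (ULoop F)) (k : ℕ), ne2At h g₀ os k = o :=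
  ⟨fun _ _ _ _ => o, fun _ _ _ _ _ _ => rfl⟩

/-! ## §6 Component locality at keyed homes, once: N15 reads ONLY the NE2 pin -/

section Locality

variable {key : (F : T4Family) → Datum F N → Prop}
  (ne2At ne2At' : ∀ {F : T4Family} {D : Datum F N}, key F D → (ℕ → ℝ) → List (ULoop F) → ℕ → NE2Objects₁₁)
  (RRec RRec' : RateRecordPred N)

/-- **COMPONENT LOCALITY — `S_N15` TRANSFERS BETWEEN HOMES OVER THE SAME KEY WHOSE NE2 READINGS AGREE** [bookkeeping]: if `RRec` attains the literals of
`ne2At`, `RRec'` admits only the literals of `ne2At'`, and the two readings coincide at every key, `(g₀, os)` and run length, then `S_N15 RRec` gives `S_N15 RRec'`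
— whatever the homes pin in `ne1` ∕ `ne3` ∕ `u3` (W1's history terms, N16's letters, NODE O's dressed tower are idle for N15): a definer's PIN of the NE2
component is ALL that N15 at a home depends on. -/
theorem s_N15_of_admits_attains_ne2_agree
    (hatt : ∀ (F : T4Family) (D : Datum F N) (h : key F D) (g₀ : ℕ → ℝ) (os : List (ULoop F)) (k : ℕ),
      ∃ R : RateCarriers N, RRec F D g₀ os R ∧ R.ne2 = ne2OfRecord₁₁ (ne2At h g₀ os k))
    (hadm' : ∀ (F : T4Family) (D : Datum F N) (g₀ : ℕ → ℝ) (os : List (ULoop F)) (R : RateCarriers N), RRec' F D g₀ os R →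
      ∃ (h : key F D) (k : ℕ), R.ne2 = ne2OfRecord₁₁ (ne2At' h g₀ os k))
    (hagree : ∀ (F : T4Family) (D : Datum F N) (h : key F D) (g₀ : ℕ → ℝ) (os : List (ULoop F)) (k : ℕ), ne2At' h g₀ os k = ne2At h g₀ os k)
    (hS : S_N15 RRec) : S_N15 RRec' :=
  s_N15_of_admits ne2At' RRec' hadm' fun F D hk g₀ os k => by
    rw [hagree F D hk g₀ os k]
    exact n15At_of_attains ne2At RRec hatt hS F D hk g₀ os k

/-- **THE PIN AS ONE POINTWISE EQUATION AT A KEYED HOME** [bookkeeping]: if the home's reading agrees at every key with a NAMED key-indexed assignment `pin` carrying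
`N15At` at every key, `(g₀, os)` and run length, then `S_N15 RRec` — the shape in which a definer's N15 pin and an estimate seat's theorem about `pin` meet, at any
stage. -/
theorem s_N15_of_admits_pin
    (hadm : ∀ (F : T4Family) (D : Datum F N) (g₀ : ℕ → ℝ) (os : List (ULoop F)) (R : RateCarriers N), RRec F D g₀ os R →
      ∃ (h : key F D) (k : ℕ), R.ne2 = ne2OfRecord₁₁ (ne2At h g₀ os k))
    (pin : ∀ {F : T4Family} {D : Datum F N}, key F D → (ℕ → ℝ) → List (ULoop F) → ℕ → NE2Objects₁₁)
    (hpin : ∀ (F : T4Family) (D : Datum F N) (h : key F D) (g₀ : ℕ → ℝ) (os : List (ULoop F)) (k : ℕ), ne2At h g₀ os k = pin h g₀ os k)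
    (hest : ∀ (F : T4Family) (D : Datum F N) (h : key F D) (g₀ : ℕ → ℝ) (os : List (ULoop F)) (k : ℕ), N15At (ne2OfRecord₁₁ (pin h g₀ os k))) :
    S_N15 RRec :=
  s_N15_of_admits ne2At RRec hadm fun F D hk g₀ os k => by
    rw [hpin F D hk g₀ os k]
    exact hest F D hk g₀ os k

end Locality

/-! ## §7 The Stage-11 instance certificates (layer B's `RRec₁₁ 𝔯`; located-vacuous at ₁₁ per LOCATED-2, kept as the pattern the Stage-12 instance follows) -/

/-- **`RRec₁₁ 𝔯` ADMITS only the NE2 literals of its reading** (`key := IsDatumOfRecord₁₁C`, `ne2At h g₀ os k := (𝔯.lit F h.params g₀ os).ne2 k`; `rfl` on the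
bundle's second component). [bookkeeping] -/
theorem admits_rRec₁₁_ne2 (𝔯 : RateReading₁₁ N) (F : T4Family) (D : Datum F N) (g₀ : ℕ → ℝ) (os : List (ULoop F)) (R : RateCarriers N)
    (hR : RRec₁₁ 𝔯 F D g₀ os R) :
    ∃ (h : IsDatumOfRecord₁₁C F N D) (k : ℕ), R.ne2 = ne2OfRecord₁₁ ((𝔯.lit F h.params g₀ os).ne2 k) := by
  obtain ⟨h, k, rfl⟩ := hR
  exact ⟨h, k, rfl⟩

/-- **`RRec₁₁ 𝔯` ATTAINS every NE2 literal of its reading** (witness: the run-length-`k` bundle `rateCarriersOfRecord₁₁ 𝔯 F h.params g₀ os k`, layer B's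
`rRec₁₁_self`). [bookkeeping] -/
theorem attains_rRec₁₁_ne2 (𝔯 : RateReading₁₁ N) (F : T4Family) (D : Datum F N) (h : IsDatumOfRecord₁₁C F N D) (g₀ : ℕ → ℝ) (os : List (ULoop F))
    (k : ℕ) : ∃ R : RateCarriers N, RRec₁₁ 𝔯 F D g₀ os R ∧ R.ne2 = ne2OfRecord₁₁ ((𝔯.lit F h.params g₀ os).ne2 k) :=
  ⟨rateCarriersOfRecord₁₁ 𝔯 F h.params g₀ os k, ⟨h, k, rfl⟩, rfl⟩

/-- **CERTIFICATE CHECK**: §1's `iff` at the Stage-11 instance IS layer B's face `s_N15_rRec₁₁_iff` (same statement, obtained here from the two certificates).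
[bookkeeping] -/
theorem s_N15_rRec₁₁_iff_keyed (𝔯 : RateReading₁₁ N) :
    S_N15 (RRec₁₁ 𝔯) ↔ ∀ (F : T4Family) (D : Datum F N) (h : IsDatumOfRecord₁₁C F N D) (g₀ : ℕ → ℝ) (os : List (ULoop F)) (k : ℕ),
      N15At (ne2OfRecord₁₁ ((𝔯.lit F h.params g₀ os).ne2 k)) :=
  s_N15_iff_of_admits_attains (key := fun F D => IsDatumOfRecord₁₁C F N D) (fun h g₀ os k => (𝔯.lit _ h.params g₀ os).ne2 k) (RRec₁₁ 𝔯)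
    (admits_rRec₁₁_ne2 𝔯) (attains_rRec₁₁_ne2 𝔯)

/-! ## §8 The family-keyed knit literal: the reading reads the datum family's block factor -/

/-- The block factor of a family is non-zero (`HistoryFlow.two_le_L`: `2 ≤ F.L`) — as a `NeZero` fact (a `Prop`), so that the knit carriers `knitInstance 3 F.L`
are available at the family's OWN `L`. [bookkeeping] -/
theorem neZero_blockFactor (F : T4Family) : NeZero F.L :=
  ⟨by have h := two_le_L F; omega⟩

section FamilyKnit

variable {key : (F : T4Family) → Datum F N → Prop}
  (ne2At : ∀ {F : T4Family} {D : Datum F N}, key F D → (ℕ → ℝ) → List (ULoop F) → ℕ → NE2Objects₁₁)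
  (RRec : RateRecordPred N)

/-- **THE FAMILY-KEYED KNIT READING CLOSES THE STUB AT ANY KEYED HOME, HYPOTHESIS-FREE** [decided toy, non-degenerate]: as `s_N15_of_admits_knit`, with the knit
carriers taken at the datum family's OWN block factor `L := F.L` (`neZero_blockFactor F` supplies the carrier's instance, `HistoryFlow.two_le_L F` the
estimate's `2 ≤ L`) — the reading READS the family; the estimate is `N15Knit.N15_with_zero_layers_dim4` at `F.L`.  Still the `U ≡ 1` torus MODEL, not Bałaban's `G(U)`.
[bookkeeping] -/
theorem s_N15_of_admits_knit_family {μ ν : Fin 4} (hμν : μ ≠ ν) (a b μ' lam α β : Fin 4) (c35 p : ℝ)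
    (hadm : ∀ (F : T4Family) (D : Datum F N) (g₀ : ℕ → ℝ) (os : List (ULoop F)) (R : RateCarriers N), RRec F D g₀ os R →
      ∃ (h : key F D) (k : ℕ), R.ne2 = ne2OfRecord₁₁ (ne2At h g₀ os k))
    (h : ∀ (F : T4Family) (D : Datum F N) (h : key F D) (g₀ : ℕ → ℝ) (os : List (ULoop F)) (k : ℕ),
      ne2At h g₀ os k =
        haveI := neZero_blockFactor F
        { I := KnitIndex 3 F.L, c35 := c35, p := p, pi := knitInstance 3 F.L, Kop := knitOp166 F.L μ ν a b, Ksite := knitSite163 F.L μ' lam,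
          Kunit := covOpKernels F.L α β, inΛ := inAll F.L, unitDist := rhoDist F.L }) :
    S_N15 RRec :=
  s_N15_of_admits ne2At RRec hadm fun F D hk g₀ os k => by
    haveI := neZero_blockFactor F
    rw [h F D hk g₀ os k]
    exact (N15_with_zero_layers_dim4 F.L (two_le_L F) hμν a b μ' lam α β c35 p).1

end FamilyKnit
end Summit.QuantumFields.YangMills.BalabanUVNodes.N15.AtKeyedHome

end
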